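import Summits.BirchSwinnertonDyer.Rank1Residual.ManinAdditive.UDCKummerWitnessLine
import HarnessLib

/-!
# The integer pole killer `(Δ^{deg P}·P(j))ⁿ` is a level-one invariant of weight `12·n·deg P`, holomorphic on `ℍ`
(route `ManinLocalTwoThree`, crux C3 `ManinPrimeToThreeAtNine` stmt-BirchSwinnertonDyer-22968; cell bsd-f2-manin, C3 LEAD p1 gen 15;
`--supports stmt-BirchSwinnertonDyer-22968`)

For -an's witness line (`UDCKummerWitnessLine`, p729921; C3 skeleton v25) the multiplier `kummerPoleKiller P n τ =
(Σ_{i ≤ deg P} pᵢ E₄(τ)^{3i} Δ(τ)^{deg P − i})ⁿ` must be (i) invariant under ALL of `SL(2, ℤ)` in weight `12·n·deg P` — used in (INV)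
`KummerMinimalWitnessInvariance` (the stabiliser of `F = C₀·block·killer` is that of the block) and in (EXT) (growth at every cusp) — and
(ii) holomorphic on `ℍ`.  Both are slash-action bookkeeping over Mathlib's `E₄ : ModularForm 𝒮ℒ 4` and `Δ : CuspForm 𝒮ℒ 12`:

* `E₄_slash`, `discriminant_slash` — the generators are `SL(2, ℤ)`-invariant in weights `4`, `12`;
* `mul_slash_eq_self`, `pow_slash_eq_self`, `add_slash_eq_self`, `sum_slash_eq_self`, `smul_slash_eq_self` — closure of invariance;
* **`kummerPoleKiller_eq`** — the killer as the function `(Σᵢ pᵢ • (E₄^{3i} · Δ^{deg P − i}))ⁿ`; **`kummerPoleKiller_slash`** —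
  `kummerPoleKiller P n ∣[12·n·deg P] g = kummerPoleKiller P n` for every `g : SL(2, ℤ)`;
* **`mdifferentiable_kummerPoleKiller`** — holomorphy on `ℍ`.

HONEST FRAMING.  Bookkeeping only; (INV)/(EXT), C3, Manin's conjecture and BSD are NOT proved here.  No definitions, no sorry. [folklore]
-/

set_option autoImplicit false
-- lint-debt: the directory name repeats the summit name (sibling precedent `ManinLocalTwoThreeUDCGlue.lean`)
set_option linter.dupNamespace false

noncomputable section

open Complex UpperHalfPlane ModularForm
open scoped Real Topology Manifold MatrixGroups ModularForm
open Summit.BirchSwinnertonDyer.Rank1Residual.ManinAdditive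

namespace Summit.BirchSwinnertonDyer.BirchSwinnertonDyer.Theorems.ManinLocalTwoThree.PoleKillerSlash

variable (g : SL(2, ℤ))

/-! ## §1 The generators -/

/-- `E₄ ∣[4] g = E₄` for every `g ∈ SL(2, ℤ)`. [folklore] -/
theorem E₄_slash : (⇑ModularForm.E₄ : ℍ → ℂ) ∣[(4 : ℤ)] g = ⇑ModularForm.E₄ := by
  rw [SL_slash]
  exact SlashInvariantFormClass.slash_action_eq ModularForm.E₄ _ ⟨g, rfl⟩

/-- `Δ ∣[12] g = Δ` for every `g ∈ SL(2, ℤ)`. [folklore] -/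
theorem discriminant_slash : (ModularForm.discriminant : ℍ → ℂ) ∣[(12 : ℤ)] g = ModularForm.discriminant := by
  rw [← CuspForm.coe_discriminant, SL_slash]
  exact SlashInvariantFormClass.slash_action_eq CuspForm.discriminant _ ⟨g, rfl⟩

/-! ## §2 Closure of invariance -/

variable {g}

/-- Products. [folklore] -/
theorem mul_slash_eq_self {f h : ℍ → ℂ} {k₁ k₂ : ℤ} (hf : f ∣[k₁] g = f) (hh : h ∣[k₂] g = h) :
    (f * h) ∣[k₁ + k₂] g = f * h := by
  rw [mul_slash_SL2, hf, hh]

/-- Powers. [folklore] -/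
theorem pow_slash_eq_self {f : ℍ → ℂ} {k : ℤ} (hf : f ∣[k] g = f) : ∀ a : ℕ, (f ^ a) ∣[(a : ℤ) * k] g = f ^ a
  | 0 => by
    rw [pow_zero, Nat.cast_zero, zero_mul]
    exact ModularForm.is_invariant_one g
  | a + 1 => by
    rw [pow_succ, show ((a + 1 : ℕ) : ℤ) * k = (a : ℤ) * k + k by push_cast; ring]
    exact mul_slash_eq_self (pow_slash_eq_self hf a) hf

/-- Sums. [folklore] -/
theorem add_slash_eq_self {f h : ℍ → ℂ} {k : ℤ} (hf : f ∣[k] g = f) (hh : h ∣[k] g = h) : (f + h) ∣[k] g = f + h := by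
  rw [SlashAction.add_slash, hf, hh]

/-- Finite sums. [folklore] -/
theorem sum_slash_eq_self {ι : Type*} (s : Finset ι) {f : ι → ℍ → ℂ} {k : ℤ} (hf : ∀ i ∈ s, (f i) ∣[k] g = f i) :
    (∑ i ∈ s, f i) ∣[k] g = ∑ i ∈ s, f i := by
  classical
  induction s using Finset.induction_on with
  | empty =>
    rw [Finset.sum_empty]
    exact SlashAction.zero_slash k g
  | insert i s hi ih =>
    rw [Finset.sum_insert hi]
    exact add_slash_eq_self (hf i (Finset.mem_insert_self i s)) (ih fun j hj ↦ hf j (Finset.mem_insert_of_mem hj))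

/-- Scalar multiples. [folklore] -/
theorem smul_slash_eq_self {f : ℍ → ℂ} {k : ℤ} (c : ℂ) (hf : f ∣[k] g = f) : (c • f) ∣[k] g = c • f := by
  rw [SL_smul_slash, hf]

/-! ## §3 The killer -/

/-- The killer as a function built from `⇑E₄` and `Δ` by pointwise operations. [folklore] -/
theorem kummerPoleKiller_eq (P : Polynomial ℤ) (n : ℕ) :
    UDCKummerWitnessLine.kummerPoleKiller P n =
      (∑ i ∈ Finset.range (P.natDegree + 1),
        ((P.coeff i : ℤ) : ℂ) • ((⇑ModularForm.E₄ : ℍ → ℂ) ^ (3 * i) * (ModularForm.discriminant : ℍ → ℂ) ^ (P.natDegree - i))) ^ n := by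
  funext τ
  simp only [UDCKummerWitnessLine.kummerPoleKiller, Pi.pow_apply, Finset.sum_apply, Pi.smul_apply, Pi.mul_apply, smul_eq_mul,
    mul_assoc]

/-- Each term `E₄^{3i} · Δ^{d − i}` (`i ≤ d`) is invariant in weight `12 d`. [folklore] -/
theorem term_slash (d i : ℕ) (hi : i ≤ d) :
    ((⇑ModularForm.E₄ : ℍ → ℂ) ^ (3 * i) * (ModularForm.discriminant : ℍ → ℂ) ^ (d - i)) ∣[(12 * d : ℤ)] g =
      (⇑ModularForm.E₄ : ℍ → ℂ) ^ (3 * i) * (ModularForm.discriminant : ℍ → ℂ) ^ (d - i) := by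
  rw [show (12 * d : ℤ) = ((3 * i : ℕ) : ℤ) * 4 + ((d - i : ℕ) : ℤ) * 12 by push_cast [Nat.cast_sub hi]; ring]
  exact mul_slash_eq_self (pow_slash_eq_self (E₄_slash g) (3 * i)) (pow_slash_eq_self (discriminant_slash g) (d - i))

/-- **The killer is `SL(2, ℤ)`-invariant in weight `12·n·deg P`.** [folklore] -/
theorem kummerPoleKiller_slash (P : Polynomial ℤ) (n : ℕ) (g : SL(2, ℤ)) :
    UDCKummerWitnessLine.kummerPoleKiller P n ∣[((12 * n * P.natDegree : ℕ) : ℤ)] g = UDCKummerWitnessLine.kummerPoleKiller P n := by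
  rw [kummerPoleKiller_eq, show ((12 * n * P.natDegree : ℕ) : ℤ) = (n : ℤ) * (12 * P.natDegree : ℤ) by push_cast; ring]
  refine pow_slash_eq_self (sum_slash_eq_self _ fun i hi ↦ ?_) n
  have hi' : i ≤ P.natDegree := Nat.lt_succ_iff.mp (Finset.mem_range.mp hi)
  exact smul_slash_eq_self _ (term_slash P.natDegree i hi')

/-- In weight `0`-style pointwise form: `killer (g • τ) · denom(g, τ)^{−12·n·deg P} = killer τ`. [folklore] -/
theorem kummerPoleKiller_smul (P : Polynomial ℤ) (n : ℕ) (g : SL(2, ℤ)) (τ : ℍ) :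
    UDCKummerWitnessLine.kummerPoleKiller P n (g • τ) * denom g τ ^ (-(((12 * n * P.natDegree : ℕ) : ℤ))) =
      UDCKummerWitnessLine.kummerPoleKiller P n τ := by
  have h := congr_fun (kummerPoleKiller_slash P n g) τ
  rwa [SL_slash_apply] at h

/-! ## §4 Holomorphy -/

/-- **The killer is holomorphic on `ℍ`.** [folklore] -/
theorem mdifferentiable_kummerPoleKiller (P : Polynomial ℤ) (n : ℕ) :
    MDifferentiable 𝓘(ℂ) 𝓘(ℂ) (UDCKummerWitnessLine.kummerPoleKiller P n) := by
  have hE : MDifferentiable 𝓘(ℂ) 𝓘(ℂ) (⇑ModularForm.E₄ : ℍ → ℂ) := ModularForm.E₄.holo'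
  have hΔ : MDifferentiable 𝓘(ℂ) 𝓘(ℂ) (ModularForm.discriminant : ℍ → ℂ) := by
    rw [← CuspForm.coe_discriminant]; exact CuspForm.discriminant.holo'
  rw [UpperHalfPlane.mdifferentiable_iff] at hE hΔ ⊢
  set T : ℕ → ℂ → ℂ := fun i z ↦
    ((P.coeff i : ℤ) : ℂ) * (ModularForm.E₄ (ofComplex z)) ^ (3 * i) * (ModularForm.discriminant (ofComplex z)) ^ (P.natDegree - i) with hT
  have hTi : ∀ i ∈ Finset.range (P.natDegree + 1), DifferentiableOn ℂ (T i) {z : ℂ | 0 < z.im} := fun i _ ↦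
    ((hE.pow (3 * i)).const_mul _).mul (hΔ.pow (P.natDegree - i))
  have hS : DifferentiableOn ℂ (∑ i ∈ Finset.range (P.natDegree + 1), T i) {z : ℂ | 0 < z.im} := DifferentiableOn.sum hTi
  have h := hS.pow n
  refine h.congr fun z _ ↦ ?_
  simp only [Function.comp_apply, UDCKummerWitnessLine.kummerPoleKiller, hT, Pi.pow_apply, Finset.sum_apply]

end Summit.BirchSwinnertonDyer.BirchSwinnertonDyer.Theorems.ManinLocalTwoThree.PoleKillerSlash

end
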